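import Literature.AlgebraicGeometry.Resolution.AlterationsSemiStable
import Literature.AlgebraicGeometry.Motives.CartierDivisor
import HarnessLib

/-!
# `WildQuotients.SummitReduction` (stmt-ResolutionOfSingularities-16324), line `FramePerfect`, skeleton v5:
# stub `stub_pair_transport` (transitivity of Galois alterations of pairs with boundary, de Jong 1997, 5.3–5.4)

Route `ResolutionOfSingularities/WildQuotients`, crux `SummitReduction`; registered stub of the line skeleton
`Cruxes/SummitReduction/Lines/FramePerfect.lean` (v5, lead c4). Worker file.
-/

set_option linter.dupNamespace false

noncomputable section

open CategoryTheory CategoryTheory.Limits AlgebraicGeometry TopologicalSpace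
open Literature.AlgebraicGeometry.Resolution
open Literature.AlgebraicGeometry.Motives (RatFn.functionFieldMap RatFn.functionFieldMap_comp)
open Literature.AlgebraicGeometry

namespace Summit.ResolutionOfSingularities.ResolutionOfSingularities.Theorems

/-- **Transitivity of Galois alterations of pairs with boundary** (de Jong 1997, 5.3–5.4: "a Galois
alteration of a Galois alteration is a Galois alteration"; the shape in which the induction step of
Thm. 5.13 / 7.3 hands its output back down). Let a finite group `G` act on an integral scheme `X` over
a field `k` (`ρ : G →* Aut X`, structure morphism `f`), `Z ⊆ X`, and let `(X', G', ρ', φ', π')` be a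
Galois alteration of the pair `(X, G)`: `φ' : G' ↠ G`, `π' : X' ⟶ X` a `φ'`-equivariant alteration with
`K(X)^G ⊂ K(X')^{G'}` purely inseparable — rendered on function fields: every `G'`-invariant
`a ∈ K(X')` has `a ^ q ^ n = π'♯ c` for a `G`-invariant `c ∈ K(X)`, `q = ringExpChar K(X)` — and
`Z' ⊇ π'⁻¹ Z`. If `(X', G', Z')` admits a regular projective Galois alteration `(X₁, G₁, ρ₁, φ₁, π₁)`
with `π₁⁻¹ Z'` inside a `G₁`-stable `G₁`-strict strict normal crossings divisor `D₁`, then so does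
`(X, G, Z)`: take the same `X₁, G₁, ρ₁, D₁` with `φ := φ' ∘ φ₁` and `π := π₁ ≫ π'`.
Proof: alterations compose (`IsAlteration.comp`, de Jong 1996, 2.20); surjections compose;
projectivity over `k` is literally the hypothesis as `(π₁ ≫ π') ≫ f = π₁ ≫ π' ≫ f`; equivariance
`ρ₁ g ≫ π₁ ≫ π' = π₁ ≫ ρ' (φ₁ g) ≫ π' = π₁ ≫ π' ≫ ρ (φ' (φ₁ g))`; for the purely inseparable clause the
exponential characteristics of `K(X)` and `K(X')` agree along the injective field map `π'♯`, and
`a ^ q ^ n = π₁♯ c`, `c ^ q ^ m = π'♯ e` give `a ^ q ^ (n + m) = (π₁ ≫ π')♯ e` by functoriality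
`(π₁ ≫ π')♯ = π₁♯ ∘ π'♯` (`RatFn.functionFieldMap_comp`); finally
`(π₁ ≫ π')⁻¹ Z = π₁⁻¹ (π'⁻¹ Z) ⊆ π₁⁻¹ Z' ⊆ D₁`. No perfectness, regularity of `X'` or kernel
condition (5.4.1) is used. [cite: DeJong1997, 5.3–5.4, pp. 613–614; proof of Thm. 5.13, p. 619]
[cite: DeJong1996, 2.20, p. 61] -/
theorem stub_pair_transport (k : Type) [Field k] (X : Scheme.{0}) [IsIntegral X]
    (f : X ⟶ Spec (.of k)) (G : Type) [Group G] [Finite G] (ρ : G →* Aut X) (Z : Set X)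
    (X' : Scheme.{0}) [IsIntegral X'] (G' : Type) [Group G'] [Finite G'] (ρ' : G' →* Aut X')
    (φ' : G' →* G) (π' : X' ⟶ X) [IsDominant π'] (hφ' : Function.Surjective φ')
    (hπ' : IsAlteration π') (hequiv : ∀ g : G', (ρ' g).hom ≫ π' = π' ≫ (ρ (φ' g)).hom)
    (hgal : (∀ a : X'.functionField, (∀ g : G', RatFn.functionFieldMap (ρ' g).hom a = a) →
        ∃ (n : ℕ) (c : X.functionField), (∀ g : G, RatFn.functionFieldMap (ρ g).hom c = c) ∧
          a ^ ringExpChar X.functionField ^ n = RatFn.functionFieldMap π' c))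
    (Z' : Set X') (hZZ' : π'.base ⁻¹' Z ⊆ Z')
    (h : ∃ (G₁ : Type) (_ : Group G₁) (_ : Finite G₁) (X₁ : Scheme.{0}) (_ : IsIntegral X₁)
        (ρ₁ : G₁ →* Aut X₁) (φ₁ : G₁ →* G') (π₁ : X₁ ⟶ X') (_ : IsDominant π₁),
        Function.Surjective φ₁ ∧ IsAlteration π₁ ∧ Scheme.IsRegular X₁ ∧
        Motives.IsProjectiveOver (Over.mk (π₁ ≫ π' ≫ f)) ∧
        (∀ g : G₁, (ρ₁ g).hom ≫ π₁ = π₁ ≫ (ρ' (φ₁ g)).hom) ∧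
        (∀ a : X₁.functionField, (∀ g : G₁, RatFn.functionFieldMap (ρ₁ g).hom a = a) →
          ∃ (n : ℕ) (c : X'.functionField), (∀ g : G', RatFn.functionFieldMap (ρ' g).hom c = c) ∧
            a ^ ringExpChar X'.functionField ^ n = RatFn.functionFieldMap π₁ c) ∧
        ∃ D₁ : Set X₁, IsStrictNormalCrossingsDivisor X₁ D₁ ∧ π₁.base ⁻¹' (Z') ⊆ D₁ ∧
          (∀ g : G₁, (ρ₁ g).hom.base '' D₁ = D₁) ∧
          (∀ (g : G₁) (C : Set X₁), Maximal (fun C : Set X₁ => IsIrreducible C ∧ C ⊆ D₁) C →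
            (C ∩ (ρ₁ g).hom.base '' C).Nonempty → (ρ₁ g).hom.base '' C = C)) :
    ∃ (G₁ : Type) (_ : Group G₁) (_ : Finite G₁) (X₁ : Scheme.{0}) (_ : IsIntegral X₁)
      (ρ₁ : G₁ →* Aut X₁) (φ₁ : G₁ →* G) (π₁ : X₁ ⟶ X) (_ : IsDominant π₁),
      Function.Surjective φ₁ ∧ IsAlteration π₁ ∧ Scheme.IsRegular X₁ ∧
      Motives.IsProjectiveOver (Over.mk (π₁ ≫ f)) ∧
      (∀ g : G₁, (ρ₁ g).hom ≫ π₁ = π₁ ≫ (ρ (φ₁ g)).hom) ∧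
      (∀ a : X₁.functionField, (∀ g : G₁, RatFn.functionFieldMap (ρ₁ g).hom a = a) →
        ∃ (n : ℕ) (c : X.functionField), (∀ g : G, RatFn.functionFieldMap (ρ g).hom c = c) ∧
          a ^ ringExpChar X.functionField ^ n = RatFn.functionFieldMap π₁ c) ∧
      ∃ D₁ : Set X₁, IsStrictNormalCrossingsDivisor X₁ D₁ ∧ π₁.base ⁻¹' (Z) ⊆ D₁ ∧
        (∀ g : G₁, (ρ₁ g).hom.base '' D₁ = D₁) ∧
        (∀ (g : G₁) (C : Set X₁), Maximal (fun C : Set X₁ => IsIrreducible C ∧ C ⊆ D₁) C →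
          (C ∩ (ρ₁ g).hom.base '' C).Nonempty → (ρ₁ g).hom.base '' C = C) := by
  obtain ⟨G₁, _, _, X₁, _, ρ₁, φ₁, π₁, _, hφ₁, hπ₁, hreg, hproj, hequiv₁, hgal₁, D₁, hD₁, hZD₁, hstab,
    hstrict⟩ := h
  -- the exponential characteristics of `K(X)` and `K(X')` agree along the field map `π'♯`
  obtain ⟨q, hq⟩ := ExpChar.exists X.functionField
  haveI : ExpChar X'.functionField q :=
    expChar_of_injective_ringHom (RatFn.functionFieldMap π').injective q
  have hqX : ringExpChar X.functionField = q := ringExpChar.eq _ q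
  have hqX' : ringExpChar X'.functionField = q := ringExpChar.eq _ q
  haveI : IsDominant (π₁ ≫ π') := inferInstance
  refine ⟨G₁, inferInstance, inferInstance, X₁, inferInstance, ρ₁, φ'.comp φ₁, π₁ ≫ π',
    inferInstance, hφ'.comp hφ₁, hπ₁.comp hπ', hreg, by simpa only [Category.assoc] using hproj,
    fun g => ?_, fun a ha => ?_, D₁, hD₁, fun x hx => hZD₁ (hZZ' hx), hstab, hstrict⟩
  · -- equivariance: `ρ₁ g ≫ π₁ ≫ π' = π₁ ≫ ρ' (φ₁ g) ≫ π' = π₁ ≫ π' ≫ ρ (φ' (φ₁ g))`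
    rw [← Category.assoc, hequiv₁ g, Category.assoc, hequiv (φ₁ g), MonoidHom.comp_apply,
      Category.assoc]
  · -- towers of purely inseparable extensions of invariant fields
    obtain ⟨n, c, hc, hac⟩ := hgal₁ a ha
    obtain ⟨m, e, he, hce⟩ := hgal c hc
    refine ⟨n + m, e, he, ?_⟩
    rw [hqX] at hce ⊢
    rw [hqX'] at hac
    rw [RatFn.functionFieldMap_comp π' π₁, RingHom.comp_apply, ← hce, map_pow, ← hac, ← pow_mul,
      ← pow_add]

end Summit.ResolutionOfSingularities.ResolutionOfSingularities.Theorems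

end
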